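import Summits.QuantumFields.YangMills.Theorems.UnitScaleTiltAxialGaugeMemberModulus
import Summits.QuantumFields.YangMills.Theorems.UnitScaleTiltProp7SectET3Transport
import HarnessLib

/-!
# `UnitScaleTiltAxialGaugeChartGlue` — THE CHART GLUE BETWEEN THE (★) MEMBER ROW AND THE (G1-3) LETTERS: the route's torus sites
# `Site (F.P K) 0` with integer translates `transl c z` ∕ relative positions `rel` (lit ✓`B10Eq27TorusAxialLog`) against the [B9] carrier
# `TSite 3 (periodsT3 F K)` with its sup circular distance `B4Sect5Torus.tdist`, read through the chart of record ✓`Prop7SectET3Transport.siteEquiv`;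
# and the two background rows `hδ`, `hΘ` of (G1-3a) ✓`Prop7CurvedMemberLocalGradient.exists_curved_localGradient` (px12 g15) AT THE TORUS AXIAL GAUGE
# `V := U₀^{axialT U₀ c}` of an (8)-regular configuration, discharged BY NAME from the (★) lineage ✓`AxialGaugeMemberModulus.dist1_axialT_le_uniform` ∕
# ✓`….dist1_axialT_translate_le_of_clauses` (route `UnitScaleTilt`, crux K1′ `MinimiserStabilityRegPr` stmt-QuantumFields-19200, (L3′b)-GRAD (G1-3b);
# px12 g15 2026-08-30 06:00Z «CHART GLUE WANTED for (G1-3b)»).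

Cell `ym3-torus` (YM ladder rung R3 = continuum SU(2) Yang–Mills on T³ — a RUNG, NOT the Clay problem: not d = 4, not infinite volume, not a mass gap);
width seat `ym3-torus-px19` (gen 13); helper `--supports stmt-QuantumFields-19200`.  THEOREMS ONLY (0 `def`, 0 `sorry`, default heartbeats).

* §1 THE CHART READS `rel`: `val (siteEquiv x i) = (x i).val`; ★`ccoord_siteEquiv`: the [B9] circular coordinate distance of two charted route sites IS
  `|rel x x′ κ|` (least-absolute-value representative — `circAbs` is `N`-periodic, even, and `= |·|` on the centred window `2|r| ≤ N`); hence
  `tdist (e x) (e x′) = max_κ |rel x x′ κ|` (`tdist_siteEquiv`), the box reading `tdist ≤ R ⇒ |rel κ| ≤ R` (`abs_rel_le_of_tdist_le`), and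
  `tdist < 1 ⇒ x′ = x` (`eq_of_tdist_siteEquiv_lt_one`).  No wrap-around hypothesis is needed for any of these.
* §2 ★★ (G-δ) `norm_bgOfCfg_axialT_sub_one_le`: on the `tdist`-ball `B(x, 4ℓ+1)` about a centre `x` within `R₀` of `e c`, for any no-wrap radius
  `R ≥ R₀ + 4ℓ + 1` (`2(R+1) ≤ sitesPerDir`): `‖↑(bgOfCfg F K V (y, μ)) − 1‖ ≤ 3·R·regThreshold F n K ε` — (G1-3a)'s `hδ` binder VERBATIM with
  `δ := 3R·εη²` (`ℓδ = 3ε·R∕ℓ`, K-free for `R ≤ r·ℓ`: `ell_mul_delta_le`).  FIRST clause of (8) only.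
* §3 ★★★ (G-Θ) `norm_bgOfCfg_axialT_sub_le`: BOTH clauses of (8), `0 ≤ ε ≤ 1`, centre `x` within `R₀` of `e c`, any no-wrap `R ≥ R₀ + 12ℓ + 1`: for
  `y, y′ ∈ B(x, 4ℓ)`, `‖↑(bgOfCfg F K V (y′, μ)) − ↑(bgOfCfg F K V (y, μ))‖ ≤ Θ·(tdist y y′∕ℓ)^{1∕2}` — (G1-3a)'s `hΘ` binder VERBATIM — with
  `Θ := (3a + 9C(a + R·b₀ + R²a²))·√(R·ℓ)`, `a = εη²`, `b₀ = εη³` (the (★) bracket at `√(S∕R) = √(ℓ∕R)·(S∕ℓ)^{1∕2}`, `S = tdist y y′` an INTEGER `≥ 1` off the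
  diagonal, `= max_κ |s_κ|` for `s := rel y y′`; the diagonal is `0 ≤ 0`); `ℓΘ ≤ ε·√r·(3 + 9C(1 + r + r²))` for `R ≤ r·ℓ` (`ell_mul_theta_le`), K-free.

HONEST SCOPE.  Chart bookkeeping + two instantiations of landed rows; nothing of (G1-3b)'s absorption, `hDcol`, the ten EX rows, `hT`, `hGF`, EX,
`MinimiserStabilityRegPr` (19200) or the rung `YM3TorusSU2` is proved; no summit statement is proved; the Yang–Mills mass gap is NOT proved.
References: [Balaban1985Averaging] (8)–(9) pp. 18–19, (19) p. 21, pp. 24–25; [Balaban1985Variational] (2), (8) p. 278; [Balaban1985UV3] (27) p. 263;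
[Balaban1985BackgroundPropagators] Thm 3.1 (3.43)–(3.44) p. 398 (the `½`-Hölder currency `(d(y,y′)∕ℓ)^{1∕2}`).
-/

set_option autoImplicit false

noncomputable section

open scoped Matrix.Norms.L2Operator
open Literature.MathematicalPhysics.QuantumFieldTheory.Balaban1983to89
open Literature.MathematicalPhysics.QuantumFieldTheory.Balaban1983to89.T3ContinuumYM3Torus (T3Family)
open Literature.MathematicalPhysics.QuantumFieldTheory.Balaban1983to89.T3RegularMinimiser (regThreshold)
open Literature.MathematicalPhysics.QuantumFieldTheory.Balaban1983to89.T3PrintedRegularMinimiser (DivSmall)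
open Literature.MathematicalPhysics.QuantumFieldTheory.Balaban1983to89.B10Eq27TorusAxialLog (transl transl_add transl_rel transl_zero rel rel_apply axialT)
open Literature.MathematicalPhysics.QuantumFieldTheory.Balaban1983to89.B4Sect5Torus (TSite tdist ccoord tdist_triangle tdist_symm tdist_nonneg
  circAbs_neg)
open Literature.MathematicalPhysics.QuantumFieldTheory.Balaban1983to89.B4TorusKernel.MultiPeriod (circAbs circAbs_add_mul circAbs_of_centred)
open Summit.QuantumFields.YangMills.Theorems.Prop7SectET3Transport (periodsT3 siteEquiv siteEquiv_apply bondEquiv bondEquiv_symm_apply bgOfCfg val_bgOfCfg)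
open Summit.QuantumFields.YangMills.Theorems.AxialGaugeTorusTransfer (dist1_mul_inv_eq_norm_sub)
open Summit.QuantumFields.YangMills.Theorems.AxialGaugeMemberModulus (dist1_axialT_le_uniform dist1_axialT_translate_le_of_clauses)

namespace Summit.QuantumFields.YangMills.Theorems.AxialGaugeChartGlue

/-! ## §1 The chart reads the relative position -/

section Chart

variable (F : T3Family) (K : ℕ)

/-- The chart coordinate is the residue's value: `val (e x)_i = (x i).val`. [folklore] -/
theorem val_siteEquiv (x : Site (F.P K) 0) (i : Fin 3) : ((siteEquiv F K x i : Fin (periodsT3 F K i)) : ℕ) = (x i).val := by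
  have key : ∀ (M : ℕ) [NeZero M] (z : ZMod M), (((ZMod.finEquiv M).symm z : Fin M) : ℕ) = z.val := by
    intro M _ z
    cases M with
    | zero => exact absurd rfl (NeZero.ne 0)
    | succ M => rfl
  rw [siteEquiv_apply]
  exact key _ (x i)

/-- ★ **THE [B9] COORDINATE DISTANCE OF TWO CHARTED SITES IS `|rel|`**: `ccoord (e x) (e x′) κ = |(x′_κ − x_κ)~|`, the least-absolute-value representative
(`circAbs` is `N`-periodic and even, and equals `|·|` on `2|r| ≤ N`). [folklore] -/
theorem ccoord_siteEquiv (x x' : Site (F.P K) 0) (κ : Fin 3) :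
    ccoord (periodsT3 F K) (siteEquiv F K x) (siteEquiv F K x') κ = (rel x x' κ).natAbs := by
  have hN0 : (F.P K).sitesPerDir 0 ≠ 0 := (F.P K).sitesPerDir_ne_zero 0
  have hN1 : 1 ≤ (F.P K).sitesPerDir 0 := Nat.one_le_iff_ne_zero.mpr hN0
  unfold ccoord
  rw [val_siteEquiv, val_siteEquiv]
  set r : ℤ := rel x x' κ with hr
  -- `x.val − x'.val ≡ −r (mod N)`
  have hdvd : ((F.P K).sitesPerDir 0 : ℤ) ∣ (((x κ).val : ℤ) - ((x' κ).val : ℤ)) - (-r) := by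
    rw [← ZMod.intCast_zmod_eq_zero_iff_dvd]
    push_cast
    rw [ZMod.natCast_zmod_val, ZMod.natCast_zmod_val, hr, rel_apply, ZMod.coe_valMinAbs]
    ring
  obtain ⟨m, hm⟩ := hdvd
  have hval : ((x κ).val : ℤ) - ((x' κ).val : ℤ) = -r + ((F.P K).sitesPerDir 0 : ℕ) * m := by linarith
  have h2r : 2 * |r| ≤ ((F.P K).sitesPerDir 0 : ℕ) := by
    have h1 : r.natAbs ≤ (F.P K).sitesPerDir 0 / 2 := by rw [hr, rel_apply]; exact ZMod.natAbs_valMinAbs_le _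
    have h2 : 2 * r.natAbs ≤ (F.P K).sitesPerDir 0 := by omega
    rw [Int.abs_eq_natAbs]; exact_mod_cast h2
  show (circAbs (periodsT3 F K κ) (((x κ).val : ℤ) - ((x' κ).val : ℤ))).toNat = r.natAbs
  rw [show periodsT3 F K κ = (F.P K).sitesPerDir 0 from rfl, hval, circAbs_add_mul, circAbs_neg hN1, circAbs_of_centred hN1 h2r,
    Int.abs_eq_natAbs, Int.toNat_natCast]

/-- `tdist (e x) (e x′) = max_κ |rel x x′ κ|` (the sup circular distance is the sup norm of the relative position). [folklore] -/
theorem tdist_siteEquiv (x x' : Site (F.P K) 0) :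
    tdist (periodsT3 F K) (siteEquiv F K x) (siteEquiv F K x') = ((Finset.univ.sup fun κ => (rel x x' κ).natAbs : ℕ) : ℝ) := by
  unfold tdist
  congr 2
  funext κ
  exact ccoord_siteEquiv F K x x' κ

/-- Each relative coordinate is bounded by the torus distance: `|rel x x′ κ| ≤ tdist (e x) (e x′)`. [folklore] -/
theorem natAbs_rel_le_tdist_siteEquiv (x x' : Site (F.P K) 0) (κ : Fin 3) :
    ((rel x x' κ).natAbs : ℝ) ≤ tdist (periodsT3 F K) (siteEquiv F K x) (siteEquiv F K x') := by
  rw [tdist_siteEquiv]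
  exact_mod_cast Finset.le_sup (f := fun κ => (rel x x' κ).natAbs) (Finset.mem_univ κ)

/-- **THE BOX READING**: `tdist (e x) (e x′) ≤ R ⇒ |rel x x′ κ| ≤ R` for every coordinate — a point of the `tdist`-ball of radius `R` about `e x` is the
translate `x + z`, `|z|_∞ ≤ R`, `z = rel x x′` (`transl_rel`). [cite: Balaban1985UV3, (27) p.263] -/
theorem abs_rel_le_of_tdist_le {x x' : Site (F.P K) 0} {R : ℕ} (h : tdist (periodsT3 F K) (siteEquiv F K x) (siteEquiv F K x') ≤ R) (κ : Fin 3) :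
    |rel x x' κ| ≤ (R : ℤ) := by
  have h1 : ((rel x x' κ).natAbs : ℝ) ≤ R := (natAbs_rel_le_tdist_siteEquiv F K x x' κ).trans h
  have h2 : (rel x x' κ).natAbs ≤ R := by exact_mod_cast h1
  rw [Int.abs_eq_natAbs]; exact_mod_cast h2

/-- Two charted sites at torus distance `< 1` coincide (the distance is an integer). [folklore] -/
theorem eq_of_tdist_siteEquiv_lt_one {x x' : Site (F.P K) 0} (h : tdist (periodsT3 F K) (siteEquiv F K x) (siteEquiv F K x') < 1) : x' = x := by
  have hz : rel x x' = 0 := by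
    funext κ
    have h1 : ((rel x x' κ).natAbs : ℝ) < 1 := (natAbs_rel_le_tdist_siteEquiv F K x x' κ).trans_lt h
    have h2 : (rel x x' κ).natAbs = 0 := by
      have : (rel x x' κ).natAbs < 1 := by exact_mod_cast h1
      omega
    exact Int.natAbs_eq_zero.mp h2
  rw [← transl_rel x x', hz, transl_zero]

/-- The same for two points of the carrier: `tdist y y′ < 1 ⇒ y = y′`. [folklore] -/
theorem eq_of_tdist_lt_one {y y' : TSite 3 (periodsT3 F K)} (h : tdist (periodsT3 F K) y y' < 1) : y = y' := by
  have h' : tdist (periodsT3 F K) (siteEquiv F K ((siteEquiv F K).symm y)) (siteEquiv F K ((siteEquiv F K).symm y')) < 1 := by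
    simpa only [Equiv.apply_symm_apply] using h
  have := eq_of_tdist_siteEquiv_lt_one F K h'
  calc y = siteEquiv F K ((siteEquiv F K).symm y) := ((siteEquiv F K).apply_symm_apply y).symm
    _ = siteEquiv F K ((siteEquiv F K).symm y') := by rw [this]
    _ = y' := (siteEquiv F K).apply_symm_apply y'

/-- The background of a configuration read at a carrier bond is the configuration at the charted route bond:
`↑(bgOfCfg F K U (y, μ)) = ↑(U ⟨e⁻¹ y, μ⟩)`. [cite: Balaban1985Averaging, (19) p.21] -/
theorem val_bgOfCfg_pair (U : GaugeField (F.P K) 0 (Matrix.specialUnitaryGroup (Fin 2) ℂ)) (y : TSite 3 (periodsT3 F K)) (μ : Fin 3) :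
    ((bgOfCfg F K U (y, μ) : (Matrix (Fin 2) (Fin 2) ℂ)ˣ) : Matrix (Fin 2) (Fin 2) ℂ) =
      ((U ⟨(siteEquiv F K).symm y, μ⟩ : Matrix.specialUnitaryGroup (Fin 2) ℂ) : Matrix (Fin 2) (Fin 2) ℂ) := by
  rw [val_bgOfCfg, bondEquiv_symm_apply]

end Chart

/-! ## §2 ★★ (G-δ): the `hδ` row of (G1-3a) at the torus axial gauge, from the first clause of (8) -/

section Delta

variable (F : T3Family) (n K : ℕ)

/-- ★★ **(G-δ) — THE `hδ` BINDER OF (G1-3a) AT `V := U₀^{axialT U₀ c}`, DISCHARGED**: if `PlaqSmall (regThreshold F n K ε) U₀` (`0 ≤ ε`), the centre `x` of the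
carrier is within `R₀` of `e c`, and `R ≥ R₀ + 4ℓ + 1` is a no-wrap radius (`2(R+1) ≤ sitesPerDir`), then on the ball `tdist x y ≤ 4ℓ + 1`:
`‖↑(bgOfCfg F K V (y, μ)) − 1‖ ≤ 3·R·regThreshold F n K ε` (`= 3R·εη²`; ✓`dist1_axialT_le_uniform` at `z := rel c (e⁻¹y)`, `|z|_∞ ≤ R`).
[cite: Balaban1985Averaging, pp.24-25; Balaban1985Variational, (2) p.278] -/
theorem norm_bgOfCfg_axialT_sub_one_le {ε : ℝ} (hε : 0 ≤ ε) (U₀ : GaugeField (F.P K) 0 (Matrix.specialUnitaryGroup (Fin 2) ℂ))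
    (hP : PlaqSmall (regThreshold F n K ε) U₀) (c : Site (F.P K) 0) (x : TSite 3 (periodsT3 F K)) {R₀ R : ℕ}
    (hx : tdist (periodsT3 F K) (siteEquiv F K c) x ≤ R₀) (hR : R₀ + 4 * F.L ^ (K - n) + 1 ≤ R) (hroom : 2 * (R + 1) ≤ (F.P K).sitesPerDir 0) :
    ∀ (y : TSite 3 (periodsT3 F K)) (μ : Fin 3), tdist (periodsT3 F K) x y ≤ 4 * (F.L : ℝ) ^ (K - n) + 1 →
      ‖((bgOfCfg F K (GaugeField.gaugeAct (axialT U₀ c) U₀) (y, μ) : (Matrix (Fin 2) (Fin 2) ℂ)ˣ) : Matrix (Fin 2) (Fin 2) ℂ) - 1‖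
        ≤ 3 * (R : ℝ) * regThreshold F n K ε := by
  intro y μ hy
  have hP1 : ∀ i, 1 ≤ periodsT3 F K i := fun i => Nat.one_le_iff_ne_zero.mpr ((F.P K).sitesPerDir_ne_zero 0)
  have ha : 0 ≤ regThreshold F n K ε := by unfold regThreshold; positivity
  set x' : Site (F.P K) 0 := (siteEquiv F K).symm y with hx'
  have hy' : siteEquiv F K x' = y := (siteEquiv F K).apply_symm_apply y
  -- the box: `|rel c x' κ| ≤ R`
  have hball : tdist (periodsT3 F K) (siteEquiv F K c) (siteEquiv F K x') ≤ (R : ℝ) := by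
    rw [hy']
    have h1 := tdist_triangle hP1 (siteEquiv F K c) x y
    have h2 : ((R₀ : ℝ)) + 4 * (F.L : ℝ) ^ (K - n) + 1 ≤ R := by exact_mod_cast hR
    linarith
  have hbox : ∀ κ, |rel c x' κ| ≤ (R : ℤ) := abs_rel_le_of_tdist_le F K hball
  have h := dist1_axialT_le_uniform U₀ ha hP c hroom (rel c x') hbox μ
  rw [transl_rel] at h
  have hd3 : (((F.P K).d : ℕ) : ℝ) = 3 := by norm_num [show (F.P K).d = 3 from rfl]
  rw [hd3] at h
  rw [val_bgOfCfg_pair]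
  exact h

/-- The K-free reading of `δ := 3R·εη²`: `ℓ·δ ≤ 3r·ε` whenever `R ≤ r·ℓ` (`ℓ = L^{K−n} = η⁻¹`). [cite: Balaban1985Variational, (2) p.278] -/
theorem ell_mul_delta_le {ε : ℝ} (hε : 0 ≤ ε) {R : ℕ} {r : ℝ} (hRr : (R : ℝ) ≤ r * (F.L : ℝ) ^ (K - n)) :
    (F.L : ℝ) ^ (K - n) * (3 * (R : ℝ) * regThreshold F n K ε) ≤ 3 * r * ε := by
  have hL1 : (1 : ℝ) ≤ (F.L : ℝ) := by have := F.hL.2; exact_mod_cast this.le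
  have hℓ : (0 : ℝ) < (F.L : ℝ) ^ (K - n) := by positivity
  unfold regThreshold
  have e2 : ((F.L : ℝ)⁻¹) ^ (2 * (K - n)) = (((F.L : ℝ) ^ (K - n)) ^ 2)⁻¹ := by rw [inv_pow, mul_comm, pow_mul]
  rw [e2]
  have hRl : (R : ℝ) / (F.L : ℝ) ^ (K - n) ≤ r := by rw [div_le_iff₀ hℓ]; exact hRr
  calc (F.L : ℝ) ^ (K - n) * (3 * (R : ℝ) * (ε * (((F.L : ℝ) ^ (K - n)) ^ 2)⁻¹))
      = 3 * ε * ((R : ℝ) / (F.L : ℝ) ^ (K - n)) := by field_simp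
    _ ≤ 3 * ε * r := mul_le_mul_of_nonneg_left hRl (by positivity)
    _ = 3 * r * ε := by ring

end Delta

/-! ## §3 ★★★ (G-Θ): the `hΘ` row of (G1-3a) at the torus axial gauge, from both clauses of (8) -/

section Theta

/-- `R·√(S∕R) = √(R·ℓ)·(S∕ℓ)^{1∕2}` — the (★) currency against the (G1-2) currency. [folklore] -/
theorem mul_sqrt_div_eq_sqrt_mul_rpow_half {R S ℓ : ℝ} (hR : 0 < R) (hS : 0 ≤ S) (hℓ : 0 < ℓ) :
    R * Real.sqrt (S / R) = Real.sqrt (R * ℓ) * (S / ℓ) ^ ((1 : ℝ) / 2) := by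
  rw [← Real.sqrt_eq_rpow, Real.sqrt_div hS, Real.sqrt_div hS, Real.sqrt_mul hR.le]
  have hℓ' : Real.sqrt ℓ ≠ 0 := (Real.sqrt_pos.mpr hℓ).ne'
  calc R * (Real.sqrt S / Real.sqrt R) = (R / Real.sqrt R) * Real.sqrt S := by ring
    _ = Real.sqrt R * Real.sqrt S := by rw [Real.div_sqrt]
    _ = Real.sqrt R * Real.sqrt ℓ * (Real.sqrt S / Real.sqrt ℓ) := by field_simp

/-- ★★★ **(G-Θ) — THE `hΘ` BINDER OF (G1-3a) AT `V := U₀^{axialT U₀ c}`, DISCHARGED FROM THE (★) MEMBER ROW.**  There is `C ≥ 0` (the (★) constant) such that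
for every member `(F, n, K)`, `0 ≤ ε ≤ 1`, every `U₀` with BOTH clauses of (8) (`PlaqSmall (regThreshold F n K ε) U₀`, `DivSmall F n K ε U₀`), every
route centre `c`, carrier centre `x` within `R₀` of `e c`, and no-wrap radius `R ≥ R₀ + 12ℓ + 1` (`2(R+1) ≤ sitesPerDir`): for `y, y′` in the ball
`tdist x · ≤ 4ℓ`,  `‖↑(bgOfCfg F K V (y′, μ)) − ↑(bgOfCfg F K V (y, μ))‖ ≤ Θ·(tdist y y′∕ℓ)^{1∕2}`,
`Θ = (3a + 3²·C·(a + R·b₀ + R²·a²))·√(R·ℓ)`, `a = ε·L^{−2(K−n)}`, `b₀ = ε·L^{−3(K−n)}`, `ℓ = L^{K−n}`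
(off the diagonal `S := tdist y y′ = |rel y y′|_∞ ≥ 1` is an admissible (★) step, `S + 1 ≤ 8ℓ + 1 ≤ R`; on it both sides vanish).
[cite: Balaban1985Averaging, pp.24-25; Balaban1985RegularSpaces, (1.7)-(1.9) p.77; Balaban1985BackgroundPropagators, Thm 3.1 (3.43) p.398] -/
theorem norm_bgOfCfg_axialT_sub_le : ∃ C : ℝ, 0 ≤ C ∧
    ∀ (F : T3Family) (n K : ℕ) (ε : ℝ), 0 ≤ ε → ε ≤ 1 →
    ∀ (U₀ : GaugeField (F.P K) 0 (Matrix.specialUnitaryGroup (Fin 2) ℂ)), PlaqSmall (regThreshold F n K ε) U₀ → DivSmall F n K ε U₀ →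
    ∀ (c : Site (F.P K) 0) (x : TSite 3 (periodsT3 F K)) (R₀ R : ℕ), tdist (periodsT3 F K) (siteEquiv F K c) x ≤ R₀ →
      R₀ + 12 * F.L ^ (K - n) + 1 ≤ R → 2 * (R + 1) ≤ (F.P K).sitesPerDir 0 →
    ∀ (y y' : TSite 3 (periodsT3 F K)) (μ : Fin 3), tdist (periodsT3 F K) x y ≤ 4 * (F.L : ℝ) ^ (K - n) → tdist (periodsT3 F K) x y' ≤ 4 * (F.L : ℝ) ^ (K - n) →
      ‖((bgOfCfg F K (GaugeField.gaugeAct (axialT U₀ c) U₀) (y', μ) : (Matrix (Fin 2) (Fin 2) ℂ)ˣ) : Matrix (Fin 2) (Fin 2) ℂ) -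
          ((bgOfCfg F K (GaugeField.gaugeAct (axialT U₀ c) U₀) (y, μ) : (Matrix (Fin 2) (Fin 2) ℂ)ˣ) : Matrix (Fin 2) (Fin 2) ℂ)‖
        ≤ ((3 * (ε * ((F.L : ℝ)⁻¹) ^ (2 * (K - n))) + (3 : ℝ) ^ 2 * (C * ((ε * ((F.L : ℝ)⁻¹) ^ (2 * (K - n))) +
            R * (ε * ((F.L : ℝ)⁻¹) ^ (3 * (K - n))) + (R : ℝ) ^ 2 * (ε * ((F.L : ℝ)⁻¹) ^ (2 * (K - n))) ^ 2))) * Real.sqrt ((R : ℝ) * (F.L : ℝ) ^ (K - n)))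
          * (tdist (periodsT3 F K) y y' / ((F.L : ℝ) ^ (K - n))) ^ ((1 : ℝ) / 2) := by
  obtain ⟨C, hC, h⟩ := dist1_axialT_translate_le_of_clauses
  refine ⟨C, hC, ?_⟩
  intro F n K ε hε hε1 U₀ hP hD c x R₀ R hx hR hroom y y' μ hy hy'
  have hP1 : ∀ i, 1 ≤ periodsT3 F K i := fun i => Nat.one_le_iff_ne_zero.mpr ((F.P K).sitesPerDir_ne_zero 0)
  have hL1 : (1 : ℝ) ≤ (F.L : ℝ) := by have := F.hL.2; exact_mod_cast this.le
  have hℓ1 : (1 : ℝ) ≤ (F.L : ℝ) ^ (K - n) := one_le_pow₀ hL1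
  have hℓ0 : (0 : ℝ) < (F.L : ℝ) ^ (K - n) := by positivity
  have hℓN : ((F.L ^ (K - n) : ℕ) : ℝ) = (F.L : ℝ) ^ (K - n) := by push_cast; rfl
  have hRℝ : (R₀ : ℝ) + 12 * (F.L : ℝ) ^ (K - n) + 1 ≤ R := by rw [← hℓN]; exact_mod_cast hR
  have hR0 : (0 : ℝ) < R := by linarith
  have hL0 : (0 : ℝ) ≤ ((F.L : ℝ)⁻¹) := inv_nonneg.2 (Nat.cast_nonneg _)
  -- the bracket is nonnegative
  have hΘ0 : 0 ≤ (3 * (ε * ((F.L : ℝ)⁻¹) ^ (2 * (K - n))) + (3 : ℝ) ^ 2 * (C * ((ε * ((F.L : ℝ)⁻¹) ^ (2 * (K - n))) +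
      R * (ε * ((F.L : ℝ)⁻¹) ^ (3 * (K - n))) + (R : ℝ) ^ 2 * (ε * ((F.L : ℝ)⁻¹) ^ (2 * (K - n))) ^ 2))) * Real.sqrt ((R : ℝ) * (F.L : ℝ) ^ (K - n)) := by
    positivity
  -- the route sites under `y`, `y'` and the integer letters
  rw [val_bgOfCfg_pair, val_bgOfCfg_pair, ← dist1_mul_inv_eq_norm_sub]
  set x₀ : Site (F.P K) 0 := (siteEquiv F K).symm y with hx₀
  set x₁ : Site (F.P K) 0 := (siteEquiv F K).symm y' with hx₁
  have hy₀ : siteEquiv F K x₀ = y := (siteEquiv F K).apply_symm_apply y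
  have hy₁ : siteEquiv F K x₁ = y' := (siteEquiv F K).apply_symm_apply y'
  -- the diagonal
  by_cases hdiag : tdist (periodsT3 F K) y y' < 1
  · have hyy : y = y' := eq_of_tdist_lt_one F K hdiag
    have hxx : x₁ = x₀ := by rw [hx₀, hx₁, hyy]
    rw [hxx, mul_inv_cancel, GaugeGroup.dist1_one]
    exact mul_nonneg hΘ0 (Real.rpow_nonneg (div_nonneg (tdist_nonneg _ _ _) hℓ0.le) _)
  -- off the diagonal: `S := tdist y y'` is an integer `≥ 1`, `≤ 8ℓ`
  rw [not_lt] at hdiag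
  set S : ℕ := Finset.univ.sup (ccoord (periodsT3 F K) y y') with hS
  have hSℝ : tdist (periodsT3 F K) y y' = (S : ℝ) := rfl
  have hS1 : 1 ≤ S := by exact_mod_cast (hSℝ ▸ hdiag : (1 : ℝ) ≤ (S : ℝ))
  have hS8 : (S : ℝ) ≤ 8 * (F.L : ℝ) ^ (K - n) := by
    have h1 := tdist_triangle hP1 y x y'
    rw [tdist_symm hP1 y x] at h1
    linarith
  have hSR : S + 1 ≤ R := by
    have : (S : ℝ) + 1 ≤ R := by linarith
    exact_mod_cast this
  have hR4 : 4 ≤ R := by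
    have : (4 : ℝ) ≤ R := by linarith
    exact_mod_cast this
  -- the letters `z := rel c x₀`, `s := rel x₀ x₁`
  have hz : ∀ κ, |rel c x₀ κ| ≤ (R : ℤ) := by
    refine abs_rel_le_of_tdist_le F K ?_
    rw [hy₀]
    have h1 := tdist_triangle hP1 (siteEquiv F K c) x y
    linarith
  have hs : ∀ κ, |rel x₀ x₁ κ| ≤ (S : ℤ) := by
    refine abs_rel_le_of_tdist_le F K ?_
    rw [hy₀, hy₁, hSℝ]
  have hzs : ∀ κ, |(rel c x₀ + rel x₀ x₁) κ| ≤ (R : ℤ) := by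
    intro κ
    rw [Pi.add_apply]
    have h1 : |rel c x₀ κ| ≤ ((R₀ + 4 * F.L ^ (K - n) : ℕ) : ℤ) := by
      refine abs_rel_le_of_tdist_le F K ?_ κ
      rw [hy₀]
      have h1 := tdist_triangle hP1 (siteEquiv F K c) x y
      push_cast; rw [← hℓN] at hy; push_cast at hy; linarith
    have h2 := hs κ
    have h3 := abs_add_le (rel c x₀ κ) (rel x₀ x₁ κ)
    have h4 : ((R₀ + 4 * F.L ^ (K - n) : ℕ) : ℤ) + S ≤ R := by
      have : (R₀ : ℝ) + 4 * (F.L : ℝ) ^ (K - n) + S ≤ R := by linarith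
      rw [← hℓN] at this
      exact_mod_cast this
    linarith
  -- the (★) member row at `(c, μ, R, S, z, s)`
  have hmain := h F n K ε hε hε1 U₀ hP hD c μ R S hR4 hroom hS1 hSR (rel c x₀) (rel x₀ x₁) hz hzs hs
  rw [transl_add, transl_rel, transl_rel] at hmain
  refine hmain.trans (le_of_eq ?_)
  have e := mul_sqrt_div_eq_sqrt_mul_rpow_half hR0 (Nat.cast_nonneg S) hℓ0
  rw [hSℝ]
  set B : ℝ := 3 * (ε * ((F.L : ℝ)⁻¹) ^ (2 * (K - n))) + (3 : ℝ) ^ 2 * (C * ((ε * ((F.L : ℝ)⁻¹) ^ (2 * (K - n))) +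
    R * (ε * ((F.L : ℝ)⁻¹) ^ (3 * (K - n))) + (R : ℝ) ^ 2 * (ε * ((F.L : ℝ)⁻¹) ^ (2 * (K - n))) ^ 2))
  calc (R : ℝ) * B * Real.sqrt ((S : ℝ) / R) = B * ((R : ℝ) * Real.sqrt ((S : ℝ) / R)) := by ring
    _ = B * (Real.sqrt ((R : ℝ) * (F.L : ℝ) ^ (K - n)) * (((S : ℝ)) / (F.L : ℝ) ^ (K - n)) ^ ((1 : ℝ) / 2)) := by rw [e]
    _ = _ := by ring

/-- The K-free reading of `Θ`: for `R ≤ r·ℓ` (`r ≥ 0`), `0 ≤ ε ≤ 1`, `ℓ·Θ ≤ ε·√r·(3 + 9C(1 + r + r²))` (`a = ε∕ℓ²`, `b₀ = ε∕ℓ³`, `ℓ ≥ 1`).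
[cite: Balaban1985Variational, (2) p.278; Balaban1985RegularSpaces, (1.9) p.77] -/
theorem ell_mul_theta_le (F : T3Family) (n K : ℕ) {ε C r : ℝ} (hε : 0 ≤ ε) (hε1 : ε ≤ 1) (hC : 0 ≤ C) (hr : 0 ≤ r) {R : ℕ}
    (hRr : (R : ℝ) ≤ r * (F.L : ℝ) ^ (K - n)) :
    (F.L : ℝ) ^ (K - n) * ((3 * (ε * ((F.L : ℝ)⁻¹) ^ (2 * (K - n))) + (3 : ℝ) ^ 2 * (C * ((ε * ((F.L : ℝ)⁻¹) ^ (2 * (K - n))) +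
        R * (ε * ((F.L : ℝ)⁻¹) ^ (3 * (K - n))) + (R : ℝ) ^ 2 * (ε * ((F.L : ℝ)⁻¹) ^ (2 * (K - n))) ^ 2))) * Real.sqrt ((R : ℝ) * (F.L : ℝ) ^ (K - n)))
      ≤ ε * Real.sqrt r * (3 + 9 * C * (1 + r + r ^ 2)) := by
  have hL1 : (1 : ℝ) ≤ (F.L : ℝ) := by have := F.hL.2; exact_mod_cast this.le
  set ℓ : ℝ := (F.L : ℝ) ^ (K - n) with hℓ
  have hℓ1 : (1 : ℝ) ≤ ℓ := one_le_pow₀ hL1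
  have hℓ0 : (0 : ℝ) < ℓ := by linarith
  have hR0 : (0 : ℝ) ≤ R := Nat.cast_nonneg R
  -- rewrite the powers of `L⁻¹` as powers of `ℓ⁻¹`
  have e2 : ((F.L : ℝ)⁻¹) ^ (2 * (K - n)) = (ℓ ^ 2)⁻¹ := by rw [inv_pow, mul_comm, pow_mul]
  have e3 : ((F.L : ℝ)⁻¹) ^ (3 * (K - n)) = (ℓ ^ 3)⁻¹ := by rw [inv_pow, mul_comm, pow_mul]
  rw [e2, e3]
  -- `√(Rℓ) ≤ ℓ√r`
  have hsq : Real.sqrt ((R : ℝ) * ℓ) ≤ ℓ * Real.sqrt r := by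
    calc Real.sqrt ((R : ℝ) * ℓ) ≤ Real.sqrt (r * ℓ * ℓ) := Real.sqrt_le_sqrt (by nlinarith)
      _ = Real.sqrt r * ℓ := by rw [mul_assoc, Real.sqrt_mul hr, Real.sqrt_mul_self hℓ0.le]
      _ = ℓ * Real.sqrt r := mul_comm _ _
  -- the bracket times `ℓ²` is `≤ ε(3 + 9C(1 + r + r²))`
  have hRl : (R : ℝ) / ℓ ≤ r := by rw [div_le_iff₀ hℓ0]; exact hRr
  have hb1 : (R : ℝ) * (ε * (ℓ ^ 3)⁻¹) ≤ r * (ε * (ℓ ^ 2)⁻¹) := by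
    have : (R : ℝ) * (ε * (ℓ ^ 3)⁻¹) = ((R : ℝ) / ℓ) * (ε * (ℓ ^ 2)⁻¹) := by field_simp
    rw [this]; exact mul_le_mul_of_nonneg_right hRl (by positivity)
  have hb2 : (R : ℝ) ^ 2 * (ε * (ℓ ^ 2)⁻¹) ^ 2 ≤ r ^ 2 * (ε * (ℓ ^ 2)⁻¹) := by
    have e : (R : ℝ) ^ 2 * (ε * (ℓ ^ 2)⁻¹) ^ 2 = ((R : ℝ) / ℓ) ^ 2 * (ε * (ε * (ℓ ^ 2)⁻¹)) := by field_simp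
    rw [e]
    calc ((R : ℝ) / ℓ) ^ 2 * (ε * (ε * (ℓ ^ 2)⁻¹)) ≤ r ^ 2 * (1 * (ε * (ℓ ^ 2)⁻¹)) :=
          mul_le_mul (pow_le_pow_left₀ (by positivity) hRl 2) (mul_le_mul_of_nonneg_right hε1 (by positivity)) (by positivity) (by positivity)
      _ = r ^ 2 * (ε * (ℓ ^ 2)⁻¹) := by rw [one_mul]
  have hbr : 3 * (ε * (ℓ ^ 2)⁻¹) + (3 : ℝ) ^ 2 * (C * (ε * (ℓ ^ 2)⁻¹ + R * (ε * (ℓ ^ 3)⁻¹) + (R : ℝ) ^ 2 * (ε * (ℓ ^ 2)⁻¹) ^ 2))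
      ≤ (ε * (ℓ ^ 2)⁻¹) * (3 + 9 * C * (1 + r + r ^ 2)) := by
    have h1 : C * (ε * (ℓ ^ 2)⁻¹ + R * (ε * (ℓ ^ 3)⁻¹) + (R : ℝ) ^ 2 * (ε * (ℓ ^ 2)⁻¹) ^ 2) ≤ C * (ε * (ℓ ^ 2)⁻¹ + r * (ε * (ℓ ^ 2)⁻¹) + r ^ 2 * (ε * (ℓ ^ 2)⁻¹)) :=
      mul_le_mul_of_nonneg_left (by linarith) hC
    nlinarith
  have hbr0 : 0 ≤ 3 * (ε * (ℓ ^ 2)⁻¹) + (3 : ℝ) ^ 2 * (C * (ε * (ℓ ^ 2)⁻¹ + R * (ε * (ℓ ^ 3)⁻¹) + (R : ℝ) ^ 2 * (ε * (ℓ ^ 2)⁻¹) ^ 2)) := by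
    positivity
  calc ℓ * ((3 * (ε * (ℓ ^ 2)⁻¹) + (3 : ℝ) ^ 2 * (C * (ε * (ℓ ^ 2)⁻¹ + R * (ε * (ℓ ^ 3)⁻¹) + (R : ℝ) ^ 2 * (ε * (ℓ ^ 2)⁻¹) ^ 2))) * Real.sqrt ((R : ℝ) * ℓ))
      ≤ ℓ * (((ε * (ℓ ^ 2)⁻¹) * (3 + 9 * C * (1 + r + r ^ 2))) * (ℓ * Real.sqrt r)) :=
        mul_le_mul_of_nonneg_left (mul_le_mul hbr hsq (Real.sqrt_nonneg _) (by positivity)) hℓ0.le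
    _ = ε * Real.sqrt r * (3 + 9 * C * (1 + r + r ^ 2)) := by field_simp

end Theta

/-! ## §4 (v1.1, APPEND-ONLY) (G-near): the route's `ℓ¹` torus distance against the carrier's sup distance -/

section Near

variable (F : T3Family) (K : ℕ)

open B3Taylor310LocalRemainder (tdist_eq_sum_natAbs tdist_comm)

/-- **THE SUP DISTANCE IS BELOW THE `ℓ¹` DISTANCE**: `tdist (e x) (e x′) ≤ Site.tdist x x′` (`max_κ |rel_κ| ≤ Σ_κ |rel_κ|`, lit ✓`tdist_eq_sum_natAbs`). [folklore] -/
theorem tdist_siteEquiv_le_site_tdist (x x' : Site (F.P K) 0) :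
    tdist (periodsT3 F K) (siteEquiv F K x) (siteEquiv F K x') ≤ (Site.tdist x x' : ℝ) := by
  rw [tdist_siteEquiv, tdist_comm, tdist_eq_sum_natAbs]
  have h : (Finset.univ.sup fun κ => (rel x x' κ).natAbs) ≤ ∑ μ : Fin (F.P K).d, ((x' μ - x μ).valMinAbs).natAbs :=
    Finset.sup_le fun κ _ => Finset.single_le_sum (f := fun μ : Fin (F.P K).d => ((x' μ - x μ).valMinAbs).natAbs) (fun _ _ => Nat.zero_le _)
      (Finset.mem_univ κ)
  exact_mod_cast h

/-- **THE `ℓ¹` DISTANCE IS AT MOST `3×` THE SUP DISTANCE**: `Site.tdist x x′ ≤ 3·tdist (e x) (e x′)` (`Σ_κ |rel_κ| ≤ d·max_κ |rel_κ|`, `d = 3`) — the bridge from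
(G1-3a)'s fine sup-ball `tdist x z ≤ 12ℓ + 3` to the COARSE `ℓ¹` input radius `D` of (G1-3b)(i)'s `hloc` (then ✓`Prop7BlockDistanceWeights.tdist_iterBlockOf_le`). [folklore] -/
theorem site_tdist_le_three_mul_tdist_siteEquiv (x x' : Site (F.P K) 0) :
    (Site.tdist x x' : ℝ) ≤ 3 * tdist (periodsT3 F K) (siteEquiv F K x) (siteEquiv F K x') := by
  rw [tdist_siteEquiv, tdist_comm, tdist_eq_sum_natAbs]
  have h : ∑ μ : Fin (F.P K).d, ((x' μ - x μ).valMinAbs).natAbs ≤ 3 * Finset.univ.sup fun κ => (rel x x' κ).natAbs := by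
    calc ∑ μ : Fin (F.P K).d, ((x' μ - x μ).valMinAbs).natAbs ≤ ∑ _μ : Fin (F.P K).d, Finset.univ.sup (fun κ => (rel x x' κ).natAbs) :=
          Finset.sum_le_sum fun μ _ => Finset.le_sup (f := fun κ => (rel x x' κ).natAbs) (Finset.mem_univ μ)
      _ = 3 * Finset.univ.sup fun κ => (rel x x' κ).natAbs := by
          rw [Finset.sum_const, Finset.card_univ, smul_eq_mul]; rfl
  exact_mod_cast h

/-- The carrier form: for `y, y′ : TSite`, `Site.tdist (e⁻¹ y) (e⁻¹ y′) ≤ 3·tdist y y′`. [folklore] -/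
theorem site_tdist_symm_le_three_mul_tdist (y y' : TSite 3 (periodsT3 F K)) :
    (Site.tdist ((siteEquiv F K).symm y) ((siteEquiv F K).symm y') : ℝ) ≤ 3 * tdist (periodsT3 F K) y y' := by
  simpa only [Equiv.apply_symm_apply] using site_tdist_le_three_mul_tdist_siteEquiv F K ((siteEquiv F K).symm y) ((siteEquiv F K).symm y')

end Near

end Summit.QuantumFields.YangMills.Theorems.AxialGaugeChartGlue

end
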